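import Summits.HodgeConjecture.HodgeConjecture.Theorems.NikulinTwinTransportSquareGlueEndomorphisms

/-!
# Route NikulinTwinTransport · `SquareGlue` (stmt-HodgeConjecture-13682) — Künneth bookkeeping VI:
# rational `(2,2)`-classes on `S × S` are algebraic

Helper file for the glue item `SquareGlue`: the degree-`4` part of `HodgeConjectureFor 4 (S ⊗ S)`
for a projective K3 surface `S` in the sector of the route (real multiplication `e` by `√2` with
algebraic class, `End_Hdg(T) ⊆ ℚ + ℚe`), GRANTED the Künneth spanning property for `(S ⊗ S)(ℂ)` in
degrees `4` and `8`, `b₁(S) = b₃(S) = 0`, Lefschetz `(1,1)` for `S`, and the named facts feeding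
`exists_algebraicClass_of_hodgeEndomorphism` and `isOfHodgeType_corrFst`. For a rational
`(2,2)`-class `c` on `S × S`: its action `[c]_*` on `H²(S)` is (up to the orientation scalar) a
rational Hodge endomorphism, hence `[Γ]_*` for an algebraic `Γ` (bookkeeping V); the actions of
`c - Γ` on `H⁰`, `H⁴` are scalars, matched by multiples of `[S × pt] = pr₂^* p₀` and
`[pt × S] = pr₁^* p₀`; a class acting trivially on `H⁰ ⊕ H² ⊕ H⁴` (and on `H¹ = H³ = 0`) is zero
(`eq_zero_of_corr_eq_zero_four`, from bookkeeping I). Prover seat prover-pitem-stmt-HodgeConjecture-13682-0.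
-/

noncomputable section

namespace Summit.HodgeConjecture.HodgeConjecture.Theorems.NikulinTwinTransport

open scoped Manifold
open Module CategoryTheory MonoidalCategory CartesianMonoidalCategory
open Literature.AlgebraicGeometry.Motives Literature.AlgebraicGeometry.HodgeTheory
open Literature.AlgebraicGeometry.Surfaces Literature.Geometry.Kaehler
open Literature.AlgebraicTopology.SingularHomology

/-! ### A class on `S × S'` acting trivially on `H⁰`, `H²`, `H⁴` of `S'` is zero -/

section Unique

variable {S S' : SchemeOver ℂ}

/-- **Uniqueness in degree `4`.** For smooth projective surfaces `S`, `S'` with `H¹(S'(ℂ)) = H³(S'(ℂ)) = 0`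
and the Künneth spanning property in degree `4` of `(S ⊗ S')(ℂ)`, a class `c ∈ H⁴((S ⊗ S')(ℂ))` whose
correspondence-type maps `w ↦ pr₁*(pr₂^* w ∪ c)` vanish on `H⁰`, `H²` and `H⁴` of `S'` is zero: its
pairings with all cross products vanish (`cupPairing_corrFst_eq`, odd degrees being zero), so
`eq_zero_of_forall_cupPairing_cross_eq_zero` applies. [cite: HatcherAT2002, §3.2 Thm. 3.15 and §3.3 Prop. 3.38] -/
theorem eq_zero_of_corr_eq_zero_four (μ : OrientationFamily)
    (hS : IsSmoothProjective 2 S) (hS' : IsSmoothProjective 2 S')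
    (hK4 : ∀ z : complexBetti (S ⊗ S') (2 * 2), z ∈ Submodule.span ℂ
      {v | ∃ (i j : ℕ) (h : i + j = 2 * 2) (b : complexBetti S i) (w : complexBetti S' j),
        v = cupProduct h (complexBetti.map (fst S S') i b) (complexBetti.map (snd S S') j w)})
    (h1 : Subsingleton (complexBetti S' 1)) (h3 : Subsingleton (complexBetti S' 3))
    {c : complexBetti (S ⊗ S') (2 * 2)}
    (hA0 : ∀ w : complexBetti S' 0,
      complexGysin μ (IsSmoothProjective.tensor_holds hS hS') hS (fst S S')
        (rfl : 2 * 2 + 2 * 2 = 0 + 2 * (2 + 2))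
        (cupProduct (Nat.zero_add (2 * 2)) (complexBetti.map (snd S S') 0 w) c) = 0)
    (hA2 : ∀ w : complexBetti S' (2 * 1),
      complexGysin μ (IsSmoothProjective.tensor_holds hS hS') hS (fst S S')
        (rfl : 2 * 1 + 2 * 2 + 2 * 2 = 2 * 1 + 2 * (2 + 2))
        (cupProduct (rfl : 2 * 1 + 2 * 2 = 2 * 1 + 2 * 2) (complexBetti.map (snd S S') (2 * 1) w) c) = 0)
    (hA4 : ∀ w : complexBetti S' (2 * 2),
      complexGysin μ (IsSmoothProjective.tensor_holds hS hS') hS (fst S S')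
        (rfl : 2 * 2 + 2 * 2 + 2 * 2 = 2 * 2 + 2 * (2 + 2))
        (cupProduct (rfl : 2 * 2 + 2 * 2 = 2 * 2 + 2 * 2) (complexBetti.map (snd S S') (2 * 2) w) c) = 0) :
    c = 0 := by
  have hsign : ∀ n : ℕ, ((-1 : ℂ) ^ n) ≠ 0 := fun n => pow_ne_zero _ (neg_ne_zero.2 one_ne_zero)
  refine eq_zero_of_forall_cupPairing_cross_eq_zero μ hS hS' (rfl : 2 * 2 + 2 * 2 = 2 * (2 + 2)) hK4
    fun i j hij b w => ?_
  rcases (show j = 0 ∨ j = 1 ∨ j = 2 * 1 ∨ j = 3 ∨ j = 2 * 2 ∨ 4 < j by omega) with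
    rfl | rfl | rfl | rfl | rfl | hj
  · obtain rfl : i = 2 * 2 := by omega
    have key := cupPairing_corrFst_eq μ hS hS' (rfl : 2 * 2 + 2 * 2 = 2 * (2 + 2)) hij
      (Nat.zero_add (2 * 2)) (rfl : 2 * 2 + 2 * 2 = 0 + 2 * (2 + 2)) (Nat.zero_add (2 * 2)) c b w
    rw [hA0 w, map_zero, LinearMap.zero_apply] at key
    exact (mul_eq_zero.1 key.symm).resolve_left (hsign _)
  · rw [Subsingleton.elim w 0, map_zero, map_zero, map_zero]
  · obtain rfl : i = 2 * 1 := by omega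
    have key := cupPairing_corrFst_eq μ hS hS' (rfl : 2 * 2 + 2 * 2 = 2 * (2 + 2)) hij
      (rfl : 2 * 1 + 2 * 2 = 2 * 1 + 2 * 2) (rfl : 2 * 1 + 2 * 2 + 2 * 2 = 2 * 1 + 2 * (2 + 2))
      (rfl : 2 * 1 + 2 * 1 = 2 * 2) c b w
    rw [hA2 w, map_zero, LinearMap.zero_apply] at key
    exact (mul_eq_zero.1 key.symm).resolve_left (hsign _)
  · rw [Subsingleton.elim w 0, map_zero, map_zero, map_zero]
  · obtain rfl : i = 0 := by omega
    have key := cupPairing_corrFst_eq μ hS hS' (rfl : 2 * 2 + 2 * 2 = 2 * (2 + 2)) hij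
      (rfl : 2 * 2 + 2 * 2 = 2 * 2 + 2 * 2) (rfl : 2 * 2 + 2 * 2 + 2 * 2 = 2 * 2 + 2 * (2 + 2))
      (Nat.add_zero (2 * 2)) c b w
    rw [hA4 w, map_zero, LinearMap.zero_apply] at key
    exact (mul_eq_zero.1 key.symm).resolve_left (hsign _)
  · haveI := subsingleton_complexBetti hS' (show 2 * 2 < j by omega)
    rw [Subsingleton.elim w 0, map_zero, map_zero, map_zero]

end Unique

/-! ### The degree-`4` part of the Hodge conjecture for `S × S` on the sector -/

section DegreeFour

variable {S : SchemeOver ℂ}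

/-- `Corr[μ, hS ; γ, y] = pr₁*(pr₂^* y ∪ γ)` on `H²(S(ℂ); ℂ)` (the route's shape). Local notation only. -/
local notation3 (prettyPrint := false) "Corr[" μ ", " hS " ; " γ ", " y "]" =>
  complexGysin μ (IsSmoothProjective.tensor_holds (And.left hS) (And.left hS)) (And.left hS)
    (SemiCartesianMonoidalCategory.fst _ _) (rfl : 2 * 1 + 2 * 2 + 2 * 2 = 2 * 1 + 2 * (2 + 2))
    (cupProduct (rfl : 2 * 1 + 2 * 2 = 2 * 1 + 2 * 2)
      (complexBetti.map (SemiCartesianMonoidalCategory.snd _ _) (2 * 1) y) γ)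

/-- **Rational `(2,2)`-classes on `S × S` are algebraic, on the sector of the route.** Let `S` be a
projective K3 surface with real multiplication `e` (rational, type-preserving, `e|_{NS} = 0`,
`e² = 2` on `NS^⊥`) whose class is algebraic (`e = [γₑ]_*`) and with `End_Hdg(T) ⊆ ℚ + ℚe` (the
uniqueness clause of `SquareHodgeOfSqrtTwo`). GRANTED the Künneth spanning property of `(S ⊗ S)(ℂ)`
in degrees `4` and `8`, `H¹(S(ℂ)) = H³(S(ℂ)) = 0`, Lefschetz `(1,1)` for `S` and the named facts
`hodgePQ_independent_of_hodgeModel`, `exists_deRhamIsoFamily`,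
`Huybrechts_K3_marking_exists`, `Huybrechts_K3_hodgeTypes_H2`,
`Grothendieck1969_supportedClasses_le_hodgeConiveau`, every rational class of type `(2,2)` in
`H⁴((S ⊗ S)(ℂ); ℂ)` lies in `N²H⁴ = algebraicClasses (S ⊗ S) 2` (the Hodge-type hypothesis supplies a
Hodge model of `S ⊗ S`; none is assumed). Proof: the action `[c]_*` on
`H²(S)` is, up to the orientation scalar `u`, rational and type-preserving
(`exists_smul_complexGysin_isRationalClass`, `isOfHodgeType_corrFst`), hence `[Γ]_*` for an
algebraic `Γ` (`exists_algebraicClass_of_hodgeEndomorphism`); the actions of `c - u⁻¹Γ` on `H⁰` and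
`H⁴` are scalars `t₀`, `t₄`, and `c - u⁻¹Γ - t₀κ⁻¹ pr₂^* p₀ - t₄κ⁻¹ pr₁^* p₀` acts trivially on
`H⁰ ⊕ H² ⊕ H⁴`, hence vanishes (`eq_zero_of_corr_eq_zero_four`). This is the `(2,2)`-part of the
Künneth bookkeeping "HC for `S²` ⟺ `End_Hdg(T(S))` algebraic" (Varesco 2023, p. 8).
[cite: Varesco2023, §2 (p. 8)] [cite: HatcherAT2002, §3.2 Thm. 3.15] -/
theorem mem_algebraicClasses_two_of_sector (hI : hodgePQ_independent_of_hodgeModel)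
    (hdR : ∀ (E : Type) [NormedAddCommGroup E] [NormedSpace ℂ E] [FiniteDimensional ℂ E],
      Literature.NumberTheory.Transcendental.exists_deRhamIsoFamily 𝓘(ℝ, E))
    (hmark : Huybrechts_K3_marking_exists) (hHT : Huybrechts_K3_hodgeTypes_H2)
    (hG : Grothendieck1969_supportedClasses_le_hodgeConiveau)
    (μ : OrientationFamily) (hS : IsK3Surface S)
    (hK4 : ∀ z : complexBetti (S ⊗ S) (2 * 2), z ∈ Submodule.span ℂ
      {v | ∃ (i j : ℕ) (h : i + j = 2 * 2) (b : complexBetti S i) (w : complexBetti S j),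
        v = cupProduct h (complexBetti.map (fst S S) i b) (complexBetti.map (snd S S) j w)})
    (hKtop : ∀ z : complexBetti (S ⊗ S) (2 * (2 + 2)), z ∈ Submodule.span ℂ
      {v | ∃ (i j : ℕ) (h : i + j = 2 * (2 + 2)) (b : complexBetti S i) (w : complexBetti S j),
        v = cupProduct h (complexBetti.map (fst S S) i b) (complexBetti.map (snd S S) j w)})
    (h1 : Subsingleton (complexBetti S 1)) (h3 : Subsingleton (complexBetti S 3))
    (hL11 : ∀ c : complexBetti S (2 * 1), IsRationalClass c → IsOfHodgeType 2 S (2 * 1) 1 1 c →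
      c ∈ algebraicClasses S 1)
    (e : complexBetti S (2 * 1) →ₗ[ℂ] complexBetti S (2 * 1))
    (he_rat : ∀ y, IsRationalClass y → IsRationalClass (e y))
    (he_N : ∀ d ∈ algebraicClasses S 1, e d = 0)
    (he_T : ∀ y : complexBetti S (2 * 1),
      (∀ d ∈ algebraicClasses S 1, cupProduct (rfl : 2 * 1 + 2 * 1 = 2 * 2) y d = 0) → e (e y) = (2 : ℂ) • y)
    (hγe : ∃ γ ∈ algebraicClasses (S ⊗ S) 2, ∀ y : complexBetti S (2 * 1), e y = Corr[μ, hS ; γ, y])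
    (hU : ∀ (f : complexBetti S (2 * 1) →ₗ[ℂ] complexBetti S (2 * 1)),
      (∀ y, IsRationalClass y → IsRationalClass (f y)) →
      (∀ (i j : ℕ) y, IsOfHodgeType 2 S (2 * 1) i j y → IsOfHodgeType 2 S (2 * 1) i j (f y)) →
      (∀ d ∈ algebraicClasses S 1, f d = 0) →
      (∀ y : complexBetti S (2 * 1), ∀ d ∈ algebraicClasses S 1,
        cupProduct (rfl : 2 * 1 + 2 * 1 = 2 * 2) (f y) d = 0) →
      ∃ a b : ℚ, ∀ y : complexBetti S (2 * 1),
        (∀ d ∈ algebraicClasses S 1, cupProduct (rfl : 2 * 1 + 2 * 1 = 2 * 2) y d = 0) →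
        f y = (a : ℂ) • y + (b : ℂ) • e y)
    (c : complexBetti (S ⊗ S) (2 * 2)) (hc : IsRationalClass c)
    (hct : IsOfHodgeType (2 + 2) (S ⊗ S) (2 * 2) 2 2 c) :
    c ∈ algebraicClasses (S ⊗ S) 2 := by
  classical
  -- Hodge models: of `S ⊗ S` from the Hodge-type hypothesis, of `S` from the K3 hypothesis
  obtain ⟨B, -⟩ := id hct
  obtain ⟨A⟩ := hS.nonempty_hodgeModel
  -- the action of `c` on `H²(S)` as a linear map
  let Fc : complexBetti S (2 * 1) →ₗ[ℂ] complexBetti S (2 * 1) :=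
    (complexGysin μ (IsSmoothProjective.tensor_holds hS.1 hS.1) hS.1 (fst S S)
        (rfl : 2 * 1 + 2 * 2 + 2 * 2 = 2 * 1 + 2 * (2 + 2))) ∘ₗ
      ((cupProduct (rfl : 2 * 1 + 2 * 2 = 2 * 1 + 2 * 2)).flip c) ∘ₗ (complexBetti.map (snd S S) (2 * 1)).hom
  have hFc : ∀ y, Fc y = Corr[μ, hS ; c, y] := fun y => rfl
  -- rational up to one scalar, and type-preserving
  obtain ⟨u, hu0, hu⟩ := exists_smul_complexGysin_isRationalClass μ
    (IsSmoothProjective.tensor_holds hS.1 hS.1) hS.1 (fst S S) (rfl : 2 * 1 + 2 * 2 + 2 * 2 = 2 * 1 + 2 * (2 + 2))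
  have hF_rat : ∀ y, IsRationalClass y → IsRationalClass ((u • Fc) y) := fun y hy => by
    rw [LinearMap.smul_apply, hFc]
    exact hu _ (IsRationalClass.cup _ (IsRationalClass.map _ hy) hc)
  have hF_typ : ∀ (i j : ℕ) y, IsOfHodgeType 2 S (2 * 1) i j y →
      IsOfHodgeType 2 S (2 * 1) i j ((u • Fc) y) := fun i j y hy => by
    rw [LinearMap.smul_apply, hFc]
    exact isOfHodgeType_smul' (isOfHodgeType_corrFst hI hdR μ hS.1 hS.1 B A
      (rfl : 2 * 1 + 2 * 2 = 2 * 1 + 2 * 2) (rfl : 2 * 1 + 2 * 2 + 2 * 2 = 2 * 1 + 2 * (2 + 2)) hct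
      (rfl : i + 2 = i + 2) (rfl : j + 2 = j + 2) hy) u
  -- `u [c]_* = [Γ]_*` with `Γ` algebraic
  obtain ⟨Γ, hΓalg, hΓ⟩ := exists_algebraicClass_of_hodgeEndomorphism hmark hHT hG μ hS hKtop hL11 e he_rat
    he_N he_T hγe hU (u • Fc) hF_rat hF_typ
  -- a generator `p₀` of `H⁴(S)`, the fibre integral `κ`
  obtain ⟨p₀, hp₀'⟩ := exists_kroneckerPairing_fundamentalClass_ne_zero μ hS.1
  have hp₀ : p₀ ≠ 0 := by
    rintro rfl
    exact hp₀' (by rw [map_zero, LinearMap.zero_apply])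
  obtain ⟨κ, hκ0, hκ⟩ := exists_fibreIntegral_fst μ hS.1 hS.1 hKtop hp₀ (rfl : 2 * 2 + 2 * 2 = 0 + 2 * (2 + 2))
  have hκinv : κ⁻¹ * κ = 1 := inv_mul_cancel₀ hκ0
  -- `c₁ = c - u⁻¹ Γ` acts trivially on `H²`
  set c₁ : complexBetti (S ⊗ S) (2 * 2) := c - u⁻¹ • Γ with hc₁
  have hA2 : ∀ y : complexBetti S (2 * 1), Corr[μ, hS ; c₁, y] = 0 := fun y => by
    have h := hΓ y
    rw [LinearMap.smul_apply, hFc] at h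
    rw [hc₁, map_sub, map_smul, map_sub, map_smul, ← h, smul_smul, inv_mul_cancel₀ hu0, one_smul, sub_self]
  -- its actions on `H⁰`, `H⁴` are scalars `t₀`, `t₄`
  obtain ⟨t₀, ht₀⟩ := exists_eq_smul_one μ hS.1
    (complexGysin μ (IsSmoothProjective.tensor_holds hS.1 hS.1) hS.1 (fst S S)
      (rfl : 2 * 2 + 2 * 2 = 0 + 2 * (2 + 2))
      (cupProduct (Nat.zero_add (2 * 2)) (complexBetti.map (snd S S) 0
        (singularCohomology.one ℂ (ComplexPoints S))) c₁))
  obtain ⟨t₄, ht₄⟩ := exists_eq_smul_of_top μ hS.1 hp₀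
    (complexGysin μ (IsSmoothProjective.tensor_holds hS.1 hS.1) hS.1 (fst S S)
      (rfl : 2 * 2 + 2 * 2 + 2 * 2 = 2 * 2 + 2 * (2 + 2))
      (cupProduct (rfl : 2 * 2 + 2 * 2 = 2 * 2 + 2 * 2) (complexBetti.map (snd S S) (2 * 2) p₀) c₁))
  -- `c₂ = c₁ - t₀κ⁻¹ pr₂^* p₀ - t₄κ⁻¹ pr₁^* p₀` acts trivially in every degree
  set c₂ : complexBetti (S ⊗ S) (2 * 2) := c₁ - (t₀ * κ⁻¹) • complexBetti.map (snd S S) (2 * 2) p₀ -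
    (t₄ * κ⁻¹) • complexBetti.map (fst S S) (2 * 2) p₀ with hc₂
  have hone : cupProduct (Nat.zero_add (2 * 2)) (singularCohomology.one ℂ (ComplexPoints S)) p₀ = (1 : ℂ) • p₀ := by
    rw [one_cupProduct, one_smul]
  have hc₂0 : c₂ = 0 := by
    refine eq_zero_of_corr_eq_zero_four μ hS.1 hS.1 hK4 h1 h3 (fun w => ?_) (fun y => ?_) (fun w => ?_)
    · -- on `H⁰`
      obtain ⟨t, rfl⟩ := exists_eq_smul_one μ hS.1 w
      rw [map_smul, LinearMap.map_smul₂, map_smul, hc₂, map_sub, map_sub, map_smul, map_smul, map_sub,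
        map_sub, map_smul, map_smul, ht₀,
        corrFst_mapSnd_of_cup_eq μ hS.1 hS.1 (Nat.zero_add (2 * 2)) _ hκ hone,
        corrFst_mapFst_eq_zero_of_lt μ hS.1 hS.1 (Nat.zero_add (2 * 2)) _ (by norm_num), smul_zero, sub_zero,
        smul_smul, one_mul, mul_assoc, hκinv, mul_one, sub_self, smul_zero]
    · -- on `H²`
      rw [hc₂, map_sub, map_sub, map_smul, map_smul, map_sub, map_sub, map_smul, map_smul, hA2 y,
        corrFst_mapSnd_eq_zero_of_lt μ hS.1 hS.1 (rfl : 2 * 1 + 2 * 2 = 2 * 1 + 2 * 2) _ (by norm_num),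
        corrFst_mapFst_eq_zero_of_lt μ hS.1 hS.1 (rfl : 2 * 1 + 2 * 2 = 2 * 1 + 2 * 2) _ (by norm_num),
        smul_zero, smul_zero, sub_zero, sub_zero]
    · -- on `H⁴`
      obtain ⟨t, rfl⟩ := exists_eq_smul_of_top μ hS.1 hp₀ w
      rw [map_smul, LinearMap.map_smul₂, map_smul, hc₂, map_sub, map_sub, map_smul, map_smul, map_sub,
        map_sub, map_smul, map_smul, ht₄,
        corrFst_mapSnd_eq_zero_of_lt μ hS.1 hS.1 (rfl : 2 * 2 + 2 * 2 = 2 * 2 + 2 * 2) _ (by norm_num),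
        corrFst_mapFst_of_fibreIntegral μ hS.1 hS.1 (rfl : 2 * 2 + 2 * 2 = 2 * 2 + 2 * 2) _ _ hκ,
        smul_zero, sub_zero, smul_smul, mul_assoc, hκinv, mul_one, sub_self, smul_zero]
  -- hence `c = u⁻¹ Γ + t₀κ⁻¹ pr₂^* p₀ + t₄κ⁻¹ pr₁^* p₀` is algebraic
  have hp₀alg : p₀ ∈ algebraicClasses S 2 := mem_algebraicClasses_of_degree_top hS.1 (by norm_num) p₀
  have hceq : c = u⁻¹ • Γ + (t₀ * κ⁻¹) • complexBetti.map (snd S S) (2 * 2) p₀ +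
      (t₄ * κ⁻¹) • complexBetti.map (fst S S) (2 * 2) p₀ := by
    rw [hc₂, hc₁, sub_sub, sub_sub, sub_eq_zero] at hc₂0
    rw [hc₂0, add_assoc]
  rw [hceq]
  exact Submodule.add_mem _ (Submodule.add_mem _ (Submodule.smul_mem _ _ hΓalg)
    (Submodule.smul_mem _ _ (map_snd_mem_algebraicClasses hS.1 hS.1 hp₀alg)))
    (Submodule.smul_mem _ _ (map_fst_mem_algebraicClasses hS.1 hS.1 hp₀alg))

end DegreeFour

end Summit.HodgeConjecture.HodgeConjecture.Theorems.NikulinTwinTransport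

end
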